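import Summits.ResolutionOfSingularities.ResolutionOfSingularities.Theorems.DeltaCutGradeCells
import HarnessLib

/-!
# SingCut — decomp-res lens-6 g30 NODE «SingCut»: THE SINGULAR REFINED CUT — the F-surf-sing door's EXIT INSIDE the
column's framework, BY CONSTRUCTION OUTSIDE the booked barrier «MirrorCut»

Host route `MaxContactCut` (route-ResolutionOfSingularities-o079-maxcontactcut), column item
`stmt-ResolutionOfSingularities-26971` (`E1TopNoAbs`); lens-6 DeltaCut column g22–g29: `E 1 ⟸ … ⟸ E1TopGHeavy` (g28 «GradeCut»,
landed `Theorems/DeltaCutGrade*`, `DeltaCutGradeCells`; g29 «MirrorCut», landed `Theorems/DeltaCutMirror*`).  g28's located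
residual is `E1TopGHeavy = E1TopGFrozen ∧ E1TopGPerpetual`: kind F-surf-sing (`GFrozen`: the graded run freezes at a level
with nothing pending, NONEMPTY bad locus, IRREGULAR reduced bad closure, not a curve, IRREGULAR SURFACE PART `Σ`; inhabited
×2: H = `z³ + (t²w − u²)⁴` — `Σ` a Whitney umbrella, singular along its handle LINE — and D′₃ = `z³ + u·t³w³` — `Σ` = two
planes crossing along a LINE) ∨ kind P″ (`GPerpetual`, no inhabitant).

## The finding behind the node (g30, NODE-g30.md §1)

The g29 barrier «MirrorCut» (`DeltaCutMirrorBarrier`, `DeltaCutMirrorRigidity`, booked row 218) obstructs, at D′, every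
MEMORYLESS law that is `Aut`-equivariant, blows up ONE regular centre per hop AND IS LOCAL (its decision at a stage is read
on an open cover).  The column's own hops are NOT local (on `U = X₀ ∖ L` the bad closure `(P_t ∖ L) ⊔ (P_w ∖ L)` is
regular, so the separating hop FIRES on `U` while it STAYS on `X₀`), and WITHOUT locality the memoryless class is NOT
obstructed at D′: the law «blow up `Sing(Σ_red)`; then blow up the strict transform of the OLD `Σ`» decides D′₃ (the
landed `Dm_memory_certificate` / `mirrorF_oldPlaneChart_*` / `planeF_newPlaneChart_*` charts, re-read).  That law is g26's
two-step device («old components first», `sepHop`: step 2 inside the SAME hop — memory WITHIN a hop, none ACROSS hops)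
one storey up, and it is this node.

## The law (canonical, choice-free, NO new state; g28's `gHop` VERBATIM off the firing stages)

At a refined stage `R` with NOTHING PENDING whose base level is `SingFrozen` — bad locus NONEMPTY, reduced closure
IRREGULAR, NOT a curve, surface part `Σ := surfacePart (badClosure n R.base)` IRREGULAR (g28's stuck reading
`gStuck_iff_surfSing` EXACTLY) AND the reduced closure of `Sing(Σ_red)` REGULAR (`SingRegular`, the new test) — the
singular hop `sHop` does STEP 1: blow up `singCentreOf Σ = 𝓘(closure Sing Σ_red)` (g27's resolving centre of the pending
phase, now taken at the SURFACE part; controlled transform) and STEP 2: if the reduced strict transform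
`closure π₁⁻¹(Σ ∖ closure Sing Σ_red)` of the OLD surface part is REGULAR (`OldSurfRegular`), blow it up too (controlled
transform); pending stays `none`.  Everywhere else `sHop = gHop` (`sHop_eq_gHop`), so below the first firing stage the
singular run IS the graded run (`sRun_eq_gRun_of_not_singNow` / `_of_gMoves`).

PERMISSIBILITY PROVED (port-free, 0 typed facts): step 1's centre is REGULAR by the test and lies INSIDE THE TOP LOCUS
(`support_singSurfCentre_subset`: `closure Sing Σ_red ⊆ Σ ⊆ closure bad ⊆ Supp(𝓘,n)`, g26's `closure_badLocus_subset_support`);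
it is NONEMPTY (`SingNow.singLocus_nonempty`: an irregular `Σ_red` has a singular point, g27's
`singLocusOf_nonempty_of_not_reducedRegular`); step 2's centre is REGULAR by the test and lies INSIDE THE NEW TOP LOCUS by
THE LIMIT-POINT LEMMA (`support_oldSurfCentre_subset_support`: orders off the centre are transported,
`IsBlowup.idealOrder_controlledTransform_of_not_mem`; limit points are caught because the support upstairs is CLOSED,
`orderUSC_holds` over the new base `baseStable_holds` — g26's `support_oldTopCentre_subset_support` with `Σ` for the old
top locus).  `sHop_facts` = all branches; ONE engine `wor_of_sTerminatesAt (h5 : SeqDimFour 5 n)` for ALL s-heights.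

LETTERS (hypothesis-free): `SMoves := GMoves ∨ SingNow`; `STerminates` [DECIDED] | `SFrozen` [kind F-ss²: stuck at a
nonempty bad locus, irregular non-curve closure, irregular surface part WHOSE SINGULAR LOCUS HAS IRREGULAR REDUCED CLOSURE]
| `SPerpetual` [kind P‴]; `s_trichotomy`, `not_sTerminates_iff`; the NON-TAUTOLOGICAL stuck reading `sStuck_iff_singSing` /
`not_sMoves_iff` / `sFrozen_iff_stuck_nonempty`.  THE SUB-KIND «F-surf-sing with REGULAR Sing-closure» IS ELIMINATED as a
letter (`gFrozen_sing_sMoves`; `GTerminates.sTerminates`, `GPerpetual.sPerpetual`, `GFrozen.sFrozen_of_not_singRegular`,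
`GFrozen.sMoves_or_sFrozen`) — and that sub-kind contains BOTH recorded inhabitants of F-surf-sing (H: Sing Σ = the
umbrella's handle, a LINE, `H_sing_axis`; D′₃: Sing Σ = the crossing LINE `L`, `Dm_crossing_line`), each S-DECIDED at
s-height 2 in dictionary currency (`SingCutCertificates.lean`: H by `H_axisChart_t`, `H1_straighten`, `H1_oldChart_w`,
`H2_newChart_t` + the new sentences `H1_top`, `H2_top_tame`, chart-`z` no-tops; D′₃ by the landed `mirrorF_lineChart_*`,
`Dm_lineChart_z_noTop`, `mirrorF_oldPlaneChart_*`, `planeF_top`, `planeF_plane_bad`, `planeF_newPlaneChart_*`,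
`Dm_memory_noTop` BY NAME).

CELLS: `WORTopGHeavySTame` [DECIDED: `worTopGHeavySTame_of_five`, `e1TopGHeavySTame_of_five (h5 : E 5)`; INHABITED by H and
D′₃] and **`WORTopSHeavy`** / **`E1TopSHeavy`** — THE LOCATED RESIDUAL after g30 = kind F-ss² `WORTopSFrozen` [INHABITED:
T₃ = `z³ + (t·u·w)⁴`, char 3 — `Σ` = the three coordinate planes of `V(z)`, `Sing Σ_red` = the three concurrent axes,
IRREGULAR at the origin; `SingCutCertificates.T3_sFrozen_certificate`] ∨ kind P‴ `WORTopSPerpetual` [UNDECIDED · no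
inhabitant · absorbs P″ and the recurrence of firing stages] (`worTopSHeavy_iff_singSing_perpetual` hyp-free,
`worTopSHeavy_iff_intrinsic`); EXACT hyp-free carve `worTopGHeavy_iff_sHeavy_sTame` / `e1TopGHeavy_iff_sHeavy_sTame`,
RE-LOCATION `e1TopGHeavy_iff_e1TopSHeavy (h5 : E 5)`, the two g28 kinds re-read (`worTopGFrozen_of_sCells`,
`worTopGPerpetual_of_sPerpetual`) and the column chain down to `e_one_iff_e1TopSHeavy (hSC) (h5)`.

BARRIER PLACEMENT (Literature/Barriers rider, NODE-g30.md §5): technique class = canonical memoryless blow-up laws read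
off the bad locus; «MirrorCut» (row 218; Kollár 2007 §3.6 Claim 3.6.3 [corpus:book:kollar2007 p.112–113]) kills the
LOCAL one-centre members at D′ — `sHop` is outside the class by its second centre inside the hop (axiom (m) of
`DeltaCutMirrorBarrier` violated by construction; (e-iso) kept: both centres are `Aut`-canonical), exactly as `sepHop` is
outside it one storey down; the price paid is visible: kind P‴ is not claimed empty, kind F-ss² is inhabited (T₃).

Provenance: HOME = run/shared/lean/pub/decomp-res, lens-6 g30 (unit decomp-res-lens-6-g30); imports the LANDED
`Theorems.DeltaCutGradeCells` + `HarnessLib`, nothing carried; namespace `…Theorems.DeltaCutClasses`, NEW sections `SDefs`,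
`SEngine`, `SCells`; every declaration new (checked by name against the landed `DeltaCut*` files); the `def … : Prop`
tests / letters / cells are THIS node's cells, none is a vendored fact.  Landing: `WRITER.md` (slices
`land/DeltaCutSing.lean` §SDefs, `DeltaCutSing2.lean` §SEngine, `DeltaCutSingCells.lean` §SCells, ≤ 400 lines each,
`--kind proof --supports stmt-ResolutionOfSingularities-26971`; the HOME-only dupNamespace-linter line dropped).

(Sources: Hironaka1964 Ch. 0 §5; CossartJannsenSaito2020 Def. 4.6 / Thm. 3.14, Ch. 5–8; CossartPiltant2019 Prop. 2.6;
Kollar2007 §3.6; BenitoVillamayor2014; HauserPerlega2024; EGAIV4 §16–§18; StacksProject 0804 / 0BIQ / 07QW; Matsumura1987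
§28–§31.)
-/

noncomputable section

open CategoryTheory CategoryTheory.Limits AlgebraicGeometry TopologicalSpace IsLocalRing
open Literature.AlgebraicGeometry.Resolution

universe u

namespace Summit.ResolutionOfSingularities.ResolutionOfSingularities.Theorems.DeltaCutClasses

open Summit.ResolutionOfSingularities.ResolutionOfSingularities.Theorems.TwistCutClasses
open Summit.ResolutionOfSingularities.ResolutionOfSingularities.Theorems.LightCutClasses

section SDefs

open Summit.ResolutionOfSingularities.ResolutionOfSingularities.Theorems
open WeakOrderReduction ForcedTowerClasses SubfieldContactClasses AbsoluteContactClasses PurityValveClasses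
open Scheme.IdealSheafData (vanishingIdeal)

/-! ### §SDefs — THE SINGULAR HOP (two steps at the `SingFrozen` levels: `Sing(Σ_red)`, then the strict transform of the OLD
surface part; g28's `gHop` elsewhere), ITS RUN, ITS LETTERS, TRICHOTOMY, THE PREFIX IDENTITIES and THE SUB-KIND THEOREM -/

/-- the step-1 centre of the singular hop — g27's resolving centre `𝓘(closure Sing Σ_red)` taken at the SURFACE PART `Σ` of the
bad closure — is supported exactly on `closure (Sing Σ_red)`. [folklore] -/
theorem coe_support_singCentreOf_surfacePart (n : ℕ) (N : Stage) :
    ((singCentreOf (surfacePart (badClosure n N))).support : Set N.Y) =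
      closure (singLocusOf (surfacePart (badClosure n N))) :=
  coe_support_vanishingIdeal _

/-- `SingRegular n N` — the REDUCED closure of the singular locus of the (reduced) surface part of the bad closure is a REGULAR
scheme (the g30 test; H: the umbrella's handle line; D′₃: the crossing line). DEFINITION (letter). -/
def SingRegular (n : ℕ) (N : Stage) : Prop := Scheme.IsRegular (singCentreOf (surfacePart (badClosure n N))).subscheme

/-- `SingFrozen n N` — the level is graded-STUCK with a nonempty bad locus (g28's reading `gStuck_iff_surfSing` VERBATIM:
bad `≠ ∅`, reduced closure irregular, not a curve, surface part irregular) AND its Sing-closure is REGULAR: the sub-kind of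
kind F-surf-sing at which the singular hop fires (both recorded inhabitants H, D′₃). DEFINITION (letter). -/
def SingFrozen (n : ℕ) (N : Stage) : Prop :=
  ¬ BadEmpty n N ∧ ¬ ClosureRegular n N ∧ ¬ DimLEOne (badClosure n N) ∧ ¬ SurfaceRegular n N ∧ SingRegular n N

/-- `SingNow n R` — the singular hop FIRES at the refined stage `R`: nothing pending and the base level is `SingFrozen`.
DEFINITION (letter). -/
def SingNow (n : ℕ) (R : RefStage) : Prop := R.pending = none ∧ SingFrozen n R.base

/-- **AT A FIRING STAGE THE STEP-1 CENTRE IS NONEMPTY** (an irregular `Σ_red` has a singular point, g27's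
`singLocusOf_nonempty_of_not_reducedRegular`): the singular hop below is a genuine blow-up. [new] [folklore] -/
theorem SingNow.singLocus_nonempty {n : ℕ} {R : RefStage} (h : SingNow n R) :
    (singLocusOf (surfacePart (badClosure n R.base))).Nonempty :=
  singLocusOf_nonempty_of_not_reducedRegular h.2.2.2.2.1

/-- … so the support of the step-1 centre is nonempty. [folklore] -/
theorem SingNow.support_nonempty {n : ℕ} {R : RefStage} (h : SingNow n R) :
    (((singCentreOf (surfacePart (badClosure n R.base))).support : Set R.base.Y)).Nonempty := by
  rw [coe_support_singCentreOf_surfacePart]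
  exact h.singLocus_nonempty.mono subset_closure

/-- **STEP 1** of the singular hop: blow up the reduced closure of `Sing(Σ_red)` and pass to the controlled transform
`(π₁^*𝓘 : 𝓔ⁿ)` (g27's `resolveStage` at `Σ`). DEFINITION (support). -/
abbrev singStepOne (n : ℕ) (N : Stage) : Stage :=
  ⟨blowup (singCentreOf (surfacePart (badClosure n N))),
    controlledTransform (blowup.π (singCentreOf (surfacePart (badClosure n N))))
      (singCentreOf (surfacePart (badClosure n N))) N.I n⟩

/-- **THE STEP-2 CENTRE** on the step-1 stage: the REDUCED closed subscheme of the closure of `π₁⁻¹(Σ ∖ closure Sing Σ_red)` —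
the STRICT TRANSFORM OF THE OLD SURFACE PART away from the step-1 centre («old components first», g26's `oldTopCentre` with
`Σ` for the old top locus; g27's `strictClosure Σ` as a reduced centre). DEFINITION (support). -/
def oldSurfCentre (n : ℕ) (N : Stage) : (singStepOne n N).Y.IdealSheafData :=
  vanishingIdeal
    ⟨closure ((blowup.π (singCentreOf (surfacePart (badClosure n N)))).base ⁻¹'
        ((surfacePart (badClosure n N) : Set N.Y) \ closure (singLocusOf (surfacePart (badClosure n N))))),
      isClosed_closure⟩

/-- the step-2 centre is the reduced ideal of g27's topological strict transform `strictClosure Σ`. [folklore] -/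
theorem oldSurfCentre_eq (n : ℕ) (N : Stage) :
    oldSurfCentre n N = vanishingIdeal (strictClosure (N := N) (surfacePart (badClosure n N))) := rfl

/-- the step-2 centre is supported exactly on the closure of `π₁⁻¹(Σ ∖ closure Sing Σ_red)`. [folklore] -/
theorem coe_support_oldSurfCentre (n : ℕ) (N : Stage) :
    ((oldSurfCentre n N).support : Set (singStepOne n N).Y) =
      closure ((blowup.π (singCentreOf (surfacePart (badClosure n N)))).base ⁻¹'
        ((surfacePart (badClosure n N) : Set N.Y) \ closure (singLocusOf (surfacePart (badClosure n N))))) :=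
  coe_support_vanishingIdeal _

/-- `OldSurfRegular n N` — the reduced strict transform of the old surface part is a REGULAR scheme (the step-2 test).
DEFINITION (letter). -/
def OldSurfRegular (n : ℕ) (N : Stage) : Prop := Scheme.IsRegular (oldSurfCentre n N).subscheme

/-- **STEP 2** of the singular hop: blow up the strict transform of the old surface part on the step-1 stage and pass to the
controlled transform. DEFINITION (support). -/
abbrev singStepTwo (n : ℕ) (N : Stage) : Stage :=
  ⟨blowup (oldSurfCentre n N), controlledTransform (blowup.π (oldSurfCentre n N)) (oldSurfCentre n N) (singStepOne n N).I n⟩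

open Classical in
/-- **THE SINGULAR REFINED HOP** (canonical, choice-free, NO new state): at a firing stage (`SingNow`: nothing pending, base
level `SingFrozen`) do STEP 1 — blow up `𝓘(closure Sing Σ_red)` —, then STEP 2 — blow up the reduced strict transform of the OLD
surface part `Σ` — if that strict transform is regular (else stop after step 1); pending stays `none`.  Everywhere else g28's
`gHop` VERBATIM. DEFINITION (the step of the singular run). -/
def sHop (n : ℕ) (R : RefStage) : RefHop R :=
  if SingNow n R then
    if OldSurfRegular n R.base then
      { next := ⟨singStepTwo n R.base, none⟩,
        hom := blowup.π (oldSurfCentre n R.base) ≫ blowup.π (singCentreOf (surfacePart (badClosure n R.base))) }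
    else
      { next := ⟨singStepOne n R.base, none⟩, hom := blowup.π (singCentreOf (surfacePart (badClosure n R.base))) }
  else gHop n R

/-- **THE SINGULAR REFINED RUN** `sRun n R : ℕ → RefStage` — iterate the singular hop (`Nat.rec`, END-iteration, as `gRun`).
DEFINITION (the object). -/
def sRun (n : ℕ) (R : RefStage) : ℕ → RefStage := fun i => Nat.rec R (fun _ P => (sHop n P).next) i

/-- level `0` of the singular run is the refined stage itself. [folklore] -/
@[simp] theorem sRun_zero (n : ℕ) (R : RefStage) : sRun n R 0 = R := rfl

/-- level `i+1` of the singular run is the singular hop of level `i`. [folklore] -/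
theorem sRun_succ (n : ℕ) (R : RefStage) (i : ℕ) : sRun n R (i + 1) = (sHop n (sRun n R i)).next := rfl

/-- **THE HOP MORPHISMS OF THE SINGULAR RUN**. DEFINITION (support). -/
def sRunHom (n : ℕ) (R : RefStage) (i : ℕ) : (sRun n R (i + 1)).base.Y ⟶ (sRun n R i).base.Y := (sHop n (sRun n R i)).hom

/-- the singular run of the next stage is the tail of the singular run. [folklore] -/
theorem sRun_succ_front (n : ℕ) (R : RefStage) : ∀ i : ℕ, sRun n R (i + 1) = sRun n (sHop n R).next i
  | 0 => rfl
  | i + 1 => by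
    show (sHop n (sRun n R (i + 1))).next = (sHop n (sRun n (sHop n R).next i)).next
    rw [sRun_succ_front n R i]

/-- at a firing stage whose old surface part has REGULAR strict transform the singular hop is step 1 followed by step 2.
[folklore] -/
theorem sHop_next_of_regular {n : ℕ} {R : RefStage} (h : SingNow n R) (h₂ : OldSurfRegular n R.base) :
    (sHop n R).next = ⟨singStepTwo n R.base, none⟩ := by
  unfold sHop; rw [if_pos h, if_pos h₂]

/-- at a firing stage whose old surface part has IRREGULAR strict transform the singular hop is step 1 alone. [folklore] -/
theorem sHop_next_of_not_regular {n : ℕ} {R : RefStage} (h : SingNow n R) (h₂ : ¬ OldSurfRegular n R.base) :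
    (sHop n R).next = ⟨singStepOne n R.base, none⟩ := by
  unfold sHop; rw [if_pos h, if_neg h₂]

/-- at a non-firing stage the singular hop is g28's graded hop. [folklore] -/
theorem sHop_eq_gHop {n : ℕ} {R : RefStage} (h : ¬ SingNow n R) : sHop n R = gHop n R := by
  unfold sHop; rw [if_neg h]

end SDefs

end Summit.ResolutionOfSingularities.ResolutionOfSingularities.Theorems.DeltaCutClasses
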